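import Summits.AtomisticToContinuum.HydrodynamicLimit.Theorems.RelayRaceLocalityNearConstantShortTimeHLTorusLipschitz
import Summits.AtomisticToContinuum.HydrodynamicLimit.Theorems.RelayRaceLocalityNearConstantShortTimeHLDerivContinuity
import HarnessLib

/-!
# Crux `NearConstantShortTimeHL` (stmt-AtomisticToContinuum-12502), line `small-tilt-domination`:
# stub `solution_box`

One box constant for the Euler profiles of a classical hard-sphere Euler solution on a closed time
slab. Given `IsHardSphereEulerSolution σ T ρ u θ`, a time `t < T` and a guard constant `M > 0` with
`M⁻¹ ≤ θ ≤ M`, `‖u‖ ≤ M` and all first spatial partial derivatives of `ρ, u, θ` bounded by `M` on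
`[0, t] × 𝕋³`, there is ONE `Mb ≥ 1` such that for every `r ∈ [0, t]`: `Mb⁻¹ ≤ ρ_r`,
`Mb⁻¹ ≤ θ_r ≤ Mb`, `‖u_r‖ ≤ Mb`, and `ρ_r, u_r, θ_r` are `Mb`-Lipschitz for the torus metric
(these are exactly the hypotheses the statics input `MesoscaleSuperlinearityE` asks of the profiles
in the Grönwall assembly of the relative-entropy method; lead c4, wave 2).

Route (folklore): (1) the density lower bound is not a guard — it comes from positivity
(`IsHardSphereEulerSolution.density_pos`) and joint continuity of `ρ` on the compact slab
`[0, t] × 𝕋³` (`continuousOn_derivs_of_isSmoothSpaceTimeOn`, extreme value theorem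
`IsCompact.exists_forall_le'`); (2) the slices `ρ_r, u_r, θ_r`, `r ∈ [0, t] ⊆ [0, T)`, are smooth
(`IsSmoothSpaceTimeOn.isSmooth_slice`) with partial derivatives bounded by `M`, hence
`3M`-Lipschitz (`abs_sub_le_of_partialDeriv_le`, `norm_sub_le_of_partialDeriv_le`);
(3) `Mb := max (max (3M) M) (max m⁻¹ 1)` dominates `1, M, 3M, m⁻¹`.

No definitions, no named facts.
-/

noncomputable section

namespace Summit.AtomisticToContinuum.HydrodynamicLimit.Theorems.NearConstantShortTimeHL

open scoped BigOperators ENNReal Topology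
open MeasureTheory Set Filter
open Literature.MathematicalPhysics.KineticTheory Literature.Analysis.FluidPDE Literature.Analysis.FunctionSpaces

/-- **Uniform positive lower bound of the density on a closed slab.** For a classical hard-sphere
Euler solution on `[0, T)` and `t < T` (with `0 ≤ t`), there is `m > 0` with `m ≤ ρ r x` for all
`r ∈ [0, t]`, `x ∈ 𝕋³`: `ρ` is positive and jointly continuous on the compact slab `[0, t] × 𝕋³`
(extreme value theorem). [folklore] -/
theorem xi_exists_pos_le_density {σ T : ℝ} {ρ θ : ℝ → T3 → ℝ} {u : ℝ → T3 → V3}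
    (hE : IsHardSphereEulerSolution σ T ρ u θ) {t : ℝ} (ht : t ∈ Ico 0 T) :
    ∃ m : ℝ, 0 < m ∧ ∀ r ∈ Icc 0 t, ∀ x, m ≤ ρ r x := by
  have hcont : ContinuousOn (Function.uncurry ρ) (Icc 0 t ×ˢ univ) :=
    (continuousOn_derivs_of_isSmoothSpaceTimeOn hE.smooth_density ht.2).1
  have hK : IsCompact (Icc (0 : ℝ) t ×ˢ (univ : Set T3)) := isCompact_Icc.prod isCompact_univ
  have hpos : ∀ p ∈ Icc (0 : ℝ) t ×ˢ (univ : Set T3), (0 : ℝ) < Function.uncurry ρ p :=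
    fun p hp => hE.density_pos p.1 ⟨hp.1.1, hp.1.2.trans_lt ht.2⟩ p.2
  obtain ⟨m, hm, hle⟩ := hK.exists_forall_le' hcont hpos
  exact ⟨m, hm, fun r hr x => hle (r, x) ⟨hr, mem_univ x⟩⟩

/-- **Registered stub `solution_box`.** One box constant `Mb ≥ 1` for the Euler profiles
`(ρ_r, u_r, θ_r)`, `r ∈ [0, t]`, of a classical hard-sphere Euler solution under the crux guards
(`M⁻¹ ≤ θ ≤ M`, `‖u‖ ≤ M`, first partial derivatives bounded by `M` on `[0, t]`): lower bounds
`Mb⁻¹ ≤ ρ_r`, `Mb⁻¹ ≤ θ_r ≤ Mb`, `‖u_r‖ ≤ Mb`, and `Mb`-Lipschitz continuity in `x` for the torus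
metric (density floor by compactness, Lipschitz constant `3M` from the gradient bounds).
[folklore] -/
theorem solution_box : ∀ {σ T : ℝ} {ρ θ : ℝ → T3 → ℝ} {u : ℝ → T3 → V3}, IsHardSphereEulerSolution σ T ρ u θ → ∀ {t : ℝ}, t ∈ Set.Ico 0 T → ∀ {M : ℝ}, 0 < M → (∀ s ∈ Set.Icc 0 t, ∀ x, θ s x ≤ M ∧ M⁻¹ ≤ θ s x ∧ ‖u s x‖ ≤ M ∧ ∀ i : Fin 3, |Torus.partialDeriv i (ρ s) x| ≤ M ∧ ‖Torus.partialDeriv i (u s) x‖ ≤ M ∧ |Torus.partialDeriv i (θ s) x| ≤ M) → ∃ Mb : ℝ, 1 ≤ Mb ∧ ∀ r ∈ Set.Icc 0 t, (∀ x, Mb⁻¹ ≤ ρ r x ∧ Mb⁻¹ ≤ θ r x ∧ θ r x ≤ Mb ∧ ‖u r x‖ ≤ Mb) ∧ (∀ x y, |ρ r x - ρ r y| ≤ Mb * dist x y ∧ ‖u r x - u r y‖ ≤ Mb * dist x y ∧ |θ r x - θ r y| ≤ Mb * dist x y) := by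
  intro σ T ρ θ u hE t ht M hM hG
  obtain ⟨m, hm, hmρ⟩ := xi_exists_pos_le_density hE ht
  -- the box constant dominates `1, M, 3M, m⁻¹`
  have hMb1 : (1 : ℝ) ≤ max (max (3 * M) M) (max m⁻¹ 1) :=
    le_max_of_le_right (le_max_right _ _)
  have hM_le : M ≤ max (max (3 * M) M) (max m⁻¹ 1) := le_max_of_le_left (le_max_right _ _)
  have h3M_le : 3 * M ≤ max (max (3 * M) M) (max m⁻¹ 1) := le_max_of_le_left (le_max_left _ _)
  have hminv_le : m⁻¹ ≤ max (max (3 * M) M) (max m⁻¹ 1) := le_max_of_le_right (le_max_left _ _)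
  have hMinv : (max (max (3 * M) M) (max m⁻¹ 1))⁻¹ ≤ M⁻¹ := inv_anti₀ hM hM_le
  have hmle : (max (max (3 * M) M) (max m⁻¹ 1))⁻¹ ≤ m := inv_le_of_inv_le₀ hm hminv_le
  refine ⟨max (max (3 * M) M) (max m⁻¹ 1), hMb1, fun r hr => ⟨fun x => ?_, fun x y => ?_⟩⟩
  · exact ⟨hmle.trans (hmρ r hr x), hMinv.trans (hG r hr x).2.1, (hG r hr x).1.trans hM_le,
      (hG r hr x).2.2.1.trans hM_le⟩
  · have hrT : r ∈ Ico 0 T := ⟨hr.1, hr.2.trans_lt ht.2⟩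
    have hρs : Torus.IsSmooth (ρ r) := hE.smooth_density.isSmooth_slice hrT
    have hus : Torus.IsSmooth (u r) := hE.smooth_velocity.isSmooth_slice hrT
    have hθs : Torus.IsSmooth (θ r) := hE.smooth_temperature.isSmooth_slice hrT
    have hdρ : ∀ i x, |Torus.partialDeriv i (ρ r) x| ≤ M := fun i x => ((hG r hr x).2.2.2 i).1
    have hdu : ∀ i x, ‖Torus.partialDeriv i (u r) x‖ ≤ M := fun i x => ((hG r hr x).2.2.2 i).2.1
    have hdθ : ∀ i x, |Torus.partialDeriv i (θ r) x| ≤ M := fun i x => ((hG r hr x).2.2.2 i).2.2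
    have hlip : 3 * M * dist x y ≤ max (max (3 * M) M) (max m⁻¹ 1) * dist x y :=
      mul_le_mul_of_nonneg_right h3M_le dist_nonneg
    exact ⟨(abs_sub_le_of_partialDeriv_le hρs hdρ x y).trans hlip,
      (norm_sub_le_of_partialDeriv_le hus hdu x y).trans hlip,
      (abs_sub_le_of_partialDeriv_le hθs hdθ x y).trans hlip⟩

end Summit.AtomisticToContinuum.HydrodynamicLimit.Theorems.NearConstantShortTimeHL

end
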